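/-
Origin: expansion seat `planner-pub-hodgecm-mc-glue-1-g9-0`, handover #372 2026-08-20T04:32Z md5 d8ee23c52009f067d1d0a21d50f23d8a (165 l.) NEW additive leaf, 3 theorem(s); NAME LIST: HodgeCM.Universe.ModelAxiomsPerL.realisationExistsPerL₂_of_ptO · HodgeCM.Assembly.perL_ofSignRecipeO₁₀ · HodgeCM.Assembly.perL_ofFunBridgesO₁₀; imports HodgeCM.Model.Binders.MeetBridges; farm build 20s rc 0 / 0 warn (`HOME/mc/pub-hodgecm-mc-glue-1-g9/stage41/HodgeCM/Model/EndStateMeetO.lean`, md5 d8ee23c52009, 165 lines);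
landed by the gen-15 packager (p-g15) in gate run 41 as `HodgeCM/Model/EndStateMeetO.lean` (verbatim).
-/
/-
Origin: glue-1 lane, seat `planner-pub-hodgecm-mc-glue-1-g9-0` (unit pub-hodgecm-mc-glue-1-g9), 2026-08-20 — item (ORIENT-h) — E-side DESIGN OF RECORD (lead 1-g59 ruling STATUS 2026-08-20T04:17:04Z l.12517 (R2) + supplement 04:24:00Z (S1)(S2); model1-g10 TYPE ✓ / PATH ✓ 04:24:14Z): the PerL end state, meeting form, over a FAMILY of theta
models indexed by the universe `(L, ι₁)` ("oriented family"), so that the sign-recipe bit may be chosen per complex place.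
ADDITIVE LEAF: imports `HodgeCM.Model.Binders.MeetBridges` only; no existing declaration touched; no hypothesis of any kind —
every statement is kernel-proved from the package as it stands.
-/
import Summits.HodgeConjecture.HodgeCM.Model.Binders.MeetBridges

/-!
# E4-O — the PerL END STATE, meeting form, over an ORIENTED FAMILY of theta models

`Universe.PerL` (`Geometry/Statements`) quantifies `∀ (ι₁ : L →+* ℂ), ι₁.comp j = φ 0 → …`: every complex embedding of the
normal closure `L` above `φ 0` is a target, and the proof of `ModelAxiomsPerL.realisationExistsPerL₂_of_pt`
(`EndStateMeet`) is POINTWISE in the target `(K, L, j, φ, ι₁, t, V)`: it reads the theta model `T` only through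
`T.exists_seesawDatum_constructed … j ι₁ …`, `T.GoodCtx ι₁ c` and the six inputs at `(V, c)`.  Hence the model may be
allowed to DEPEND ON THE TARGET UNIVERSE: below, `T : ∀ (L : CMField), (L →+* ℂ) → U.ThetaModel` is a family and every
input is demanded for the member `T L ι₁` at the universe `(L, ι₁)` at hand.  With
`T L ι₁ := C.thetaModel (hb L ι₁) d12 d34` (`hb : ∀ L : CMField, (L →+* ℂ) → Bool` a per-place recipe bit) this is the
"oriented recipe bit" of item (ORIENT-h); with a constant family it is `EndStateMeet` / `MeetBridges` verbatim.

Contents: `realisationExistsPerL₂_of_ptO` (family form of `realisationExistsPerL₂_of_pt`), and the two headlines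
`Assembly.perL_ofSignRecipeO₁₀` (six meeting inputs) and `Assembly.perL_ofFunBridgesO₁₀` (function-level bridges) for
the family `fun L ι₁ => C.thetaModel (hb L ι₁) d12 d34`.
-/

noncomputable section

open scoped InnerProductSpace

namespace HodgeCM

open HodgeCM.Prior.Perl34File

namespace Universe

variable {U : Universe}

namespace ModelAxiomsPerL

/-- **`RealisationExistsPerL₂` from the pointwise meeting inputs of a FAMILY of theta models** `T L ι₁`, each member
read only at its own universe `(L, ι₁)`: the proof of `realisationExistsPerL₂_of_pt`, with `T ↦ T L ι₁` after the target
is fixed. -/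
theorem realisationExistsPerL₂_of_ptO (M : U.ModelAxiomsPerL) (T : ∀ (L : CMField), (L →+* ℂ) → U.ThetaModel)
    (hHR : U.Fact_hodgeRiemann20)
    (hκ : ∀ (L : CMField) (ι₁ : L →+* ℂ), (T L ι₁).Design_kappaConj)
    (hs : ∀ (L : CMField) (ι₁ : L →+* ℂ), (T L ι₁).Design_frameSignConj)
    {S : ∀ {L : CMField}, SeesawCtx L → Prop}
    (hS : ∀ {L : CMField} (c : SeesawCtx L), Module.finrank ℚ c.K = 6 → S c)
    (innerEmb : ∀ {L : CMField} {ι₁ : L →+* ℂ} (V : HermSpace3 L ι₁) (c : SeesawCtx L),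
      (T L ι₁).GoodCtx ι₁ c → S c → (T L ι₁).InnerEmbAt V)
    (thetaSub : ∀ {L : CMField} {ι₁ : L →+* ℂ} (V : HermSpace3 L ι₁) (c : SeesawCtx L),
      (T L ι₁).GoodCtx ι₁ c → S c →
      ∀ (i : Fin 4) (Γ : Level V), (T L ι₁).Theta V c i Γ ⊆ U.Uiso Γ c.K (c.Ψ i) c.σ)
    (thetaWedge : ∀ {L : CMField} {ι₁ : L →+* ℂ} (V : HermSpace3 L ι₁) (c : SeesawCtx L),
      (T L ι₁).GoodCtx ι₁ c → S c →
      ∃ Γ : Level V, ∃ ω₁ ∈ (T L ι₁).Theta V c 0 Γ, ∃ ω₂ ∈ (T L ι₁).Theta V c 1 Γ,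
        U.cup2C (U.pms L ι₁ V Γ) 1 ω₁ ω₂ ≠ 0)
    (gen12Meet : ∀ {L : CMField} {ι₁ : L →+* ℂ} (V : HermSpace3 L ι₁) (c : SeesawCtx L),
      (T L ι₁).GoodCtx ι₁ c → S c → (T L ι₁).Gen12MeetAt V c)
    (real34Meet : ∀ {L : CMField} {ι₁ : L →+* ℂ} (V : HermSpace3 L ι₁) (c : SeesawCtx L),
      (T L ι₁).GoodCtx ι₁ c → S c → (T L ι₁).Real34MeetAt V c)
    (occ : ∀ {L : CMField} {ι₁ : L →+* ℂ} (V : HermSpace3 L ι₁) (c : SeesawCtx L),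
      (T L ι₁).GoodCtx ι₁ c → S c →
      (∀ (Φ : (T L ι₁).SK V c) (i : (T L ι₁).SigIdx V c),
          (∃ v ∈ ((T L ι₁).core V c).hatσ i, ((T L ι₁).core V c).TΦ Φ v ≠ 0) → ((T L ι₁).t12 V c).wOccurs i) ∧
        (∀ (Φ : (T L ι₁).SK V c) (i : (T L ι₁).SigIdx V c),
          (∃ v ∈ ((T L ι₁).core V c).hatσ i, ((T L ι₁).core V c).TΦ Φ v ≠ 0) → ((T L ι₁).t34 V c).wOccurs i)) :
    U.RealisationExistsPerL₂ := by
  intro K L j _ hK _ φ hφ ι₁ hι₁ t ht V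
  have hmem : ∀ i, φ 0 ∈ (t i).1 := fun i => (ht i 0).mpr (by fin_cases i <;> rfl)
  have hΨ : PairSum t := StubTree.pairSum_of_isPerLTypes K φ hφ hK t ht
  obtain ⟨D, hD⟩ := (T L ι₁).exists_seesawDatum_constructed (hκ L ι₁) (hs L ι₁) j ι₁ t hΨ
  let c : SeesawCtx L := ⟨K, t, φ 0, D⟩
  have hc : (T L ι₁).GoodCtx ι₁ c := ⟨hΨ, StubTree.injective_of_isPerLTypes K φ hφ t ht, hmem, ⟨j, hι₁, hD⟩⟩
  have hSc : S c := hS c hK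
  exact nonempty_thetaRealisation₂_at_allChars M (T L ι₁) hHR V c (innerEmb V c hc hSc) (thetaSub V c hc hSc)
    (thetaWedge V c hc hSc) (gen12Meet V c hc hSc) (real34Meet V c hc hSc) (occ V c hc hSc)

end ModelAxiomsPerL

end Universe

/-! ## Headlines for the oriented family `fun L ι₁ => C.thetaModel (hb L ι₁) d12 d34` -/

namespace Assembly

open HodgeCM.Universe (AdelicThetaCore₀ SideData ThetaModel ModelAxiomsPerL)

variable (U : Universe)

/-- **E4-O, POINTWISE with a PER-PLACE RECIPE BIT**: `perL_ofSignRecipe₁₀` with the global `(h : Bool)` replaced by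
`hb : ∀ L : CMField, (L →+* ℂ) → Bool`, every input at the universe `(L, ι₁)` typed against the model at bit `hb L ι₁`. -/
theorem perL_ofSignRecipeO₁₀ (M : U.ModelAxiomsPerL) (hb : ∀ L : CMField, (L →+* ℂ) → Bool) (C : U.AdelicThetaCore₀)
    (d12 d34 : ∀ {L : CMField}, SeesawCtx L → SideData L) {S : ∀ {L : CMField}, SeesawCtx L → Prop}
    (hS : ∀ {L : CMField} (c : SeesawCtx L), Module.finrank ℚ c.K = 6 → S c)
    (innerEmb : ∀ {L : CMField} {ι₁ : L →+* ℂ} (V : HermSpace3 L ι₁) (c : SeesawCtx L),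
      (C.thetaModel (hb L ι₁) d12 d34).GoodCtx ι₁ c → S c → (C.thetaModel (hb L ι₁) d12 d34).InnerEmbAt V)
    (thetaSub : ∀ {L : CMField} {ι₁ : L →+* ℂ} (V : HermSpace3 L ι₁) (c : SeesawCtx L),
      (C.thetaModel (hb L ι₁) d12 d34).GoodCtx ι₁ c → S c →
      ∀ (i : Fin 4) (Γ : Level V), (C.thetaModel (hb L ι₁) d12 d34).Theta V c i Γ ⊆ U.Uiso Γ c.K (c.Ψ i) c.σ)
    (thetaWedge : ∀ {L : CMField} {ι₁ : L →+* ℂ} (V : HermSpace3 L ι₁) (c : SeesawCtx L),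
      (C.thetaModel (hb L ι₁) d12 d34).GoodCtx ι₁ c → S c →
      ∃ Γ : Level V, ∃ ω₁ ∈ (C.thetaModel (hb L ι₁) d12 d34).Theta V c 0 Γ,
        ∃ ω₂ ∈ (C.thetaModel (hb L ι₁) d12 d34).Theta V c 1 Γ, U.cup2C (U.pms L ι₁ V Γ) 1 ω₁ ω₂ ≠ 0)
    (gen12Meet : ∀ {L : CMField} {ι₁ : L →+* ℂ} (V : HermSpace3 L ι₁) (c : SeesawCtx L),
      (C.thetaModel (hb L ι₁) d12 d34).GoodCtx ι₁ c → S c → (C.thetaModel (hb L ι₁) d12 d34).Gen12MeetAt V c)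
    (real34Meet : ∀ {L : CMField} {ι₁ : L →+* ℂ} (V : HermSpace3 L ι₁) (c : SeesawCtx L),
      (C.thetaModel (hb L ι₁) d12 d34).GoodCtx ι₁ c → S c → (C.thetaModel (hb L ι₁) d12 d34).Real34MeetAt V c)
    (occ : ∀ {L : CMField} {ι₁ : L →+* ℂ} (V : HermSpace3 L ι₁) (c : SeesawCtx L),
      (C.thetaModel (hb L ι₁) d12 d34).GoodCtx ι₁ c → S c →
      (∀ (Φ : (C.thetaModel (hb L ι₁) d12 d34).SK V c) (i : (C.thetaModel (hb L ι₁) d12 d34).SigIdx V c),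
          (∃ v ∈ ((C.thetaModel (hb L ι₁) d12 d34).core V c).hatσ i,
            ((C.thetaModel (hb L ι₁) d12 d34).core V c).TΦ Φ v ≠ 0) →
          ((C.thetaModel (hb L ι₁) d12 d34).t12 V c).wOccurs i) ∧
        (∀ (Φ : (C.thetaModel (hb L ι₁) d12 d34).SK V c) (i : (C.thetaModel (hb L ι₁) d12 d34).SigIdx V c),
          (∃ v ∈ ((C.thetaModel (hb L ι₁) d12 d34).core V c).hatσ i,
            ((C.thetaModel (hb L ι₁) d12 d34).core V c).TΦ Φ v ≠ 0) →
          ((C.thetaModel (hb L ι₁) d12 d34).t34 V c).wOccurs i))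
    (hHR : U.Fact_hodgeRiemann20) : U.PerL :=
  M.perL₂ (M.realisationExistsPerL₂_of_ptO (fun L ι₁ => C.thetaModel (hb L ι₁) d12 d34) hHR
    (fun L ι₁ => C.design_kappaConj (hb L ι₁) d12 d34) (fun L ι₁ => C.design_frameSignConj (hb L ι₁) d12 d34) hS
    innerEmb thetaSub thetaWedge gen12Meet real34Meet occ)

/-- **₁₀-O over the FUNCTION-LEVEL bridges** with a per-place recipe bit: `perL_ofFunBridges₁₀` with `h ↦ hb L ι₁`
inside every input (the bridges are turned into the meeting statements pointwise, as in
`ThetaModel.AllCharsNonDesignPt₂.ofFunBridges`). -/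
theorem perL_ofFunBridgesO₁₀ (M : U.ModelAxiomsPerL) (hb : ∀ L : CMField, (L →+* ℂ) → Bool) (C : U.AdelicThetaCore₀)
    (d12 d34 : ∀ {L : CMField}, SeesawCtx L → SideData L) {S : ∀ {L : CMField}, SeesawCtx L → Prop}
    (hS : ∀ {L : CMField} (c : SeesawCtx L), Module.finrank ℚ c.K = 6 → S c)
    (innerEmb : ∀ {L : CMField} {ι₁ : L →+* ℂ} (V : HermSpace3 L ι₁) (c : SeesawCtx L),
      (C.thetaModel (hb L ι₁) d12 d34).GoodCtx ι₁ c → S c → (C.thetaModel (hb L ι₁) d12 d34).InnerEmbAt V)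
    (thetaSub : ∀ {L : CMField} {ι₁ : L →+* ℂ} (V : HermSpace3 L ι₁) (c : SeesawCtx L),
      (C.thetaModel (hb L ι₁) d12 d34).GoodCtx ι₁ c → S c →
      ∀ (i : Fin 4) (Γ : Level V), (C.thetaModel (hb L ι₁) d12 d34).Theta V c i Γ ⊆ U.Uiso Γ c.K (c.Ψ i) c.σ)
    (thetaWedge : ∀ {L : CMField} {ι₁ : L →+* ℂ} (V : HermSpace3 L ι₁) (c : SeesawCtx L),
      (C.thetaModel (hb L ι₁) d12 d34).GoodCtx ι₁ c → S c →
      ∃ Γ : Level V, ∃ ω₁ ∈ (C.thetaModel (hb L ι₁) d12 d34).Theta V c 0 Γ,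
        ∃ ω₂ ∈ (C.thetaModel (hb L ι₁) d12 d34).Theta V c 1 Γ, U.cup2C (U.pms L ι₁ V Γ) 1 ω₁ ω₂ ≠ 0)
    (gen12 : ∀ {L : CMField} {ι₁ : L →+* ℂ} (V : HermSpace3 L ι₁) (c : SeesawCtx L),
      (C.thetaModel (hb L ι₁) d12 d34).GoodCtx ι₁ c → S c →
      Nonempty ((C.thetaModel (hb L ι₁) d12 d34).Gen12FunBridge V c))
    (real34 : ∀ {L : CMField} {ι₁ : L →+* ℂ} (V : HermSpace3 L ι₁) (c : SeesawCtx L),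
      (C.thetaModel (hb L ι₁) d12 d34).GoodCtx ι₁ c → S c →
      Nonempty ((C.thetaModel (hb L ι₁) d12 d34).Real34FunBridge V c))
    (occ : ∀ {L : CMField} {ι₁ : L →+* ℂ} (V : HermSpace3 L ι₁) (c : SeesawCtx L),
      (C.thetaModel (hb L ι₁) d12 d34).GoodCtx ι₁ c → S c →
      (∀ (Φ : (C.thetaModel (hb L ι₁) d12 d34).SK V c) (i : (C.thetaModel (hb L ι₁) d12 d34).SigIdx V c),
          (∃ v ∈ ((C.thetaModel (hb L ι₁) d12 d34).core V c).hatσ i,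
            ((C.thetaModel (hb L ι₁) d12 d34).core V c).TΦ Φ v ≠ 0) →
          ((C.thetaModel (hb L ι₁) d12 d34).t12 V c).wOccurs i) ∧
        (∀ (Φ : (C.thetaModel (hb L ι₁) d12 d34).SK V c) (i : (C.thetaModel (hb L ι₁) d12 d34).SigIdx V c),
          (∃ v ∈ ((C.thetaModel (hb L ι₁) d12 d34).core V c).hatσ i,
            ((C.thetaModel (hb L ι₁) d12 d34).core V c).TΦ Φ v ≠ 0) →
          ((C.thetaModel (hb L ι₁) d12 d34).t34 V c).wOccurs i))
    (hHR : U.Fact_hodgeRiemann20) : U.PerL :=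
  perL_ofSignRecipeO₁₀ U M hb C d12 d34 hS innerEmb thetaSub thetaWedge
    (fun {L} {ι₁} V c hc hSc => (C.thetaModel (hb L ι₁) d12 d34).gen12MeetAt_of_nonempty_funBridge (gen12 V c hc hSc))
    (fun {L} {ι₁} V c hc hSc => (C.thetaModel (hb L ι₁) d12 d34).real34MeetAt_of_nonempty_funBridge (real34 V c hc hSc))
    occ hHR

end Assembly

end HodgeCM

end
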